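import Summits.NavierStokesRegularity.FluidComputer.PalasekTowerHeredityWitnessTower
import Summits.NavierStokesRegularity.FluidComputer.PalasekTowerRegisterGlobalCeiling
import Summits.NavierStokesRegularity.FluidComputer.PalasekTowerViscosity

/-!
# REGISTER v2.3′: HEREDITY OR BREAKDOWN — the heredity items weakened LOSSLESSLY for Clay (C)

Cell `ns-blowup`, seat `ns-palasek-19250-p2` (g2; STUB-WORKER on `stub_apriori_ceiling : AprioriCeiling` of
crux stmt-NavierStokesRegularity-19250 `HeredityFromTwo`, birth skeleton v3 c7f4b5fa45c722f3). Companion of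
`PalasekTowerRegisterGlobalHeredity.lean` (p415576: `HeredityAt`, `HeredityFrom`, `ContinuationEnvelope`,
`ReadoutFloors`), `PalasekTowerRegisterGlobalCeiling.lean` (p425507: `AprioriCeiling`),
`PalasekTowerHeredityWitnessTower.lean` (`navierStokesBreakdownR3_of_nonempty_stages`) and
`PalasekTowerHeredityWitnessUnconditional.lean` (`Stage.velocity_eq_of_classical`). LABEL: E–C typing
(KERNEL vocabulary + glue; every implication proved). WHAT THIS IS NOT: not Navier–Stokes evidence — no
schedule, stage, flow or tower is constructed; the three named open `Prop`s below are NEVER asserted;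
nothing here claims regularity or blow-up.

## The observation

The register's heredity `HeredityAt k` asks that EVERY registered stage at level `k` of a pinned rigid
quiet design EXTENDS to level `k + 1`. Its upper half (`ContinuationEnvelope ↔ AprioriCeiling`, p422740)
therefore contains the clause «the design's flow does not blow up before `τ (k+1)`» — the a-priori
ceiling is quantified over every PARTIAL window `[0, T'] ⊆ [0, τ (k+1)]`, so a registered design whose free
flow overshoots `c₂ Y_{k+1}` at some `T' < τ (k+1)` and then loses smoothness before `τ (k+1)` REFUTES
`HeredityAt k`. But such a design is by itself a witness of Fefferman's (C): its Clay datum and Clay-class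
force admit no global smooth bounded-energy solution (restriction to `[0, τ (k+1)]`; every viscosity by
`isClassicalNSSolutionOn_viscosityChange`). So the route's target needs only the WEAKER items

`HeredityOrBreakdownAt k := ∀ adm S, ∀ s : Stage k, ¬ S.LivesTo 1 (τ (k+1)) ∨ ∃ s', s.Extends s'`.

## Contents

* §1 `Schedule.LivesTo S ν T` (the design's flow is classical with finite energy on `[0, T]`; the first
  three conjuncts of `Schedule.LevelWitness`), `Stage.livesTo`, `LivesTo.mono`, `LivesTo.of_claySolution`.
* §2 THE BREAKDOWN DOOR `Schedule.navierStokesBreakdownR3_of_not_livesTo`: a design with smooth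
  divergence-free Clay datum whose flow does not live to some `T > 0` at ONE viscosity gives (C) at ALL.
* §3 `HeredityOrBreakdownAt k`, `HeredityOrBreakdownFrom k₀`, `NoPrematureBreakdownAt k` (never asserted);
  `HeredityAt k ↔ HeredityOrBreakdownAt k ∧ NoPrematureBreakdownAt k`;
  `¬ NoPrematureBreakdownAt k → NavierStokesBreakdownR3`; hence
  `HeredityOrBreakdownAt k → HeredityAt k ∨ NavierStokesBreakdownR3` and
  `¬ NavierStokesBreakdownR3 → (HeredityAt k ↔ HeredityOrBreakdownAt k)`.
* §4 THE CLOSER with weakened binders: `EpisodeBaseG → HeredityOrBreakdownFrom 1 → NavierStokesBreakdownR3`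
  (the chain of one design either reaches every level — `navierStokesBreakdownR3_of_nonempty_stages` — or
  dies at a finite level — §2), and the split form `EpisodeBaseG → HeredityOrBreakdownAt 1 →
  HeredityOrBreakdownFrom 2 → NavierStokesBreakdownR3`.
* §5 The weak item in certificate shape: `HeredityOrBreakdownAt k ↔ ∀ adm S, Nonempty (Stage k) →
  S.LivesTo 1 (τ (k+1)) → S.LevelWitness 1 k` («the heredity witness of every design that SURVIVES»).

References: S. Palasek, arXiv:2605.13827 §4 [cite: Palasek2026ElementaryModel, §4]; C. L. Fefferman, Clay
problem description, (C) [cite: FeffermanClay2006, (C)]; T. Tao, Anal. PDE 6 (2013), footnote 3 and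
Cor. 11.4 [cite: Tao2011, footnote 3]; H. Sohr, *The Navier–Stokes Equations*, Birkhäuser 2001, Ch. V
Thm. 1.5.1 [cite: Sohr2001, Ch. V Thm. 1.5.1].
-/

noncomputable section

namespace Summit.NavierStokesRegularity.FluidComputer.PalasekTowerClayBridge

open Set MeasureTheory Filter Topology Function
open scoped ENNReal ContDiff NNReal
open Literature.Analysis.FluidPDE
open Summit.NavierStokesRegularity.NavierStokesRegularity

/-! ## §1 The life of a design -/

/-- **The design's flow LIVES to time `T` at viscosity `ν`**: there is an exact classical solution
`(u, p)` of the forced system with the schedule's force `S.f` from its Clay datum `S.u₀` on the CLOSED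
slab `[0, T] × ℝ³`, with finite energy there (any pressure gauge). By unconditional uniqueness this is a
statement about THE flow of the design: it keeps smoothness and finite energy until `T`. These are
the first three conjuncts of `Schedule.LevelWitness`. [cite: FeffermanClay2006, (C) (6) (7)] -/
def Schedule.LivesTo {R : TowerRates} (S : Schedule R) (ν T : ℝ) : Prop :=
  ∃ (u : ℝ → EuclideanSpace ℝ (Fin 3) → EuclideanSpace ℝ (Fin 3))
    (p : ℝ → EuclideanSpace ℝ (Fin 3) → ℝ),
    IsClassicalNSSolutionOn (Icc 0 T) ν S.f u p ∧ u 0 = S.u₀ ∧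
    ∃ C : ℝ≥0∞, C < ⊤ ∧ ∀ t ∈ Icc 0 T, ∫⁻ x, ‖u t x‖ₑ ^ 2 ≤ C

namespace Schedule

variable {R : TowerRates} {S : Schedule R} {ν T T' : ℝ}

/-- Living to `T` implies living to every earlier positive time. [folklore] -/
theorem LivesTo.mono (h : S.LivesTo ν T) (hT' : 0 < T') (hle : T' ≤ T) : S.LivesTo ν T' := by
  obtain ⟨u, p, hcl, h0, C, hC, hb⟩ := h
  exact ⟨u, p, hcl.mono (Icc_subset_Icc le_rfl hle) (uniqueDiffOn_Icc hT'), h0, C, hC,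
    fun t ht => hb t ⟨ht.1, ht.2.trans hle⟩⟩

/-- **A global Clay-class solution of the design's system lives forever**: a pair `(v, q)` jointly
smooth on `[0, ∞) × ℝ³`, solving the forced system with the design's force from its datum, with
bounded energy (Fefferman (1)–(3), (6), (7)), restricts to a witness of `S.LivesTo ν T` for every
`T > 0`. [cite: FeffermanClay2006, (6) (7)] -/
theorem LivesTo.of_claySolution (hT : 0 < T)
    {v : ℝ → EuclideanSpace ℝ (Fin 3) → EuclideanSpace ℝ (Fin 3)}
    {q : ℝ → EuclideanSpace ℝ (Fin 3) → ℝ}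
    (hv : IsSmoothOnHalfSpace v) (hq : IsSmoothOnHalfSpace q)
    (hns : IsNavierStokesSolution ν S.f S.u₀ v q) (hE : HasBoundedEnergy v) : S.LivesTo ν T := by
  obtain ⟨C, hC, hb⟩ := hE
  have hcl : IsClassicalNSSolutionOn (Ici 0) ν S.f v q ∧ v 0 = S.u₀ :=
    isNavierStokesSolution_and_smooth_iff.mp ⟨hns, hv, hq⟩
  exact ⟨v, q, hcl.1.mono (fun _ ht => ht.1) (uniqueDiffOn_Icc hT), hcl.2, C, hC,
    fun t ht => hb t ht.1⟩

/-- **No life, no global Clay-class solution** (one viscosity): if the design's flow does not live to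
some `T > 0`, then no pair jointly smooth on `[0, ∞) × ℝ³` with bounded energy solves the design's
forced system from its datum. [cite: FeffermanClay2006, (C)] -/
theorem not_exists_claySolution_of_not_livesTo (hT : 0 < T) (h : ¬ S.LivesTo ν T) :
    ¬ ∃ (v : ℝ → EuclideanSpace ℝ (Fin 3) → EuclideanSpace ℝ (Fin 3))
        (q : ℝ → EuclideanSpace ℝ (Fin 3) → ℝ),
        IsSmoothOnHalfSpace v ∧ IsSmoothOnHalfSpace q ∧
          IsNavierStokesSolution ν S.f S.u₀ v q ∧ HasBoundedEnergy v := by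
  rintro ⟨v, q, hv, hq, hns, hE⟩
  exact h (LivesTo.of_claySolution hT hv hq hns hE)

end Schedule

namespace Stage

variable {ν : ℝ} {R : TowerRates} {S : Schedule R} {m : Margins R} {k : ℕ}

/-- A stage at level `k` shows that its design lives to `τ k` (its own velocity and pressure). [folklore] -/
theorem livesTo (s : Stage ν R S m k) : S.LivesTo ν (S.τ k) :=
  ⟨s.u, s.p, s.classical, s.initial, s.energy⟩

/-- The Clay datum of a design carrying a stage is divergence free (slice `t = 0` of a classical
solution). [folklore] -/
theorem divFree_datum (s : Stage ν R S m k) : NSWave0.IsDivFree S.u₀ := by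
  rw [← s.initial]
  exact s.classical.divFree 0 ⟨le_rfl, (S.τ_pos k).le⟩

end Stage

/-! ## §2 The breakdown door: a design that dies early IS Fefferman's (C), at every viscosity -/

section Door

variable {E : Type*} [NormedAddCommGroup E] [NormedSpace ℝ E] {F : Type*} [NormedAddCommGroup F]
  [NormedSpace ℝ F]

omit [NormedAddCommGroup E] [NormedSpace ℝ E] in
/-- Undoing a time dilation: `timeRescale a⁻¹ c (timeRescale a d w) = w` when `a ≠ 0`, `c * d = 1`.
[folklore] -/
theorem timeRescale_inv_timeRescale {a : ℝ} (ha : a ≠ 0) {c d : ℝ} (hcd : c * d = 1)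
    (w : ℝ → E → F) : timeRescale a⁻¹ c (timeRescale a d w) = w := by
  funext s x
  simp only [timeRescale_apply, smul_smul, hcd, one_smul, mul_inv_cancel_left₀ ha]

end Door

namespace Schedule

variable {R : TowerRates}

/-- **THE BREAKDOWN DOOR.** Let `S` be a schedule (any rates) whose Clay datum is smooth and
divergence free, and suppose that at some viscosity `μ > 0` the design's flow does NOT live to some
`T > 0` (no classical finite-energy solution of the forced system from the datum on `[0, T]`). Then
Fefferman's (C) `NavierStokesBreakdownR3` holds — at EVERY viscosity `ν > 0`: take the dilated data
`a • u₀`, `a² • f(a t, x)`, `a = ν/μ` (Clay classes preserved: `hasRapidSpatialDecay_const_smul`,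
`isSmoothOnHalfSpace_timeRescale`, `hasRapidSpaceTimeDecay_timeRescale`); a global smooth bounded-energy
solution for them at viscosity `ν` would dilate back (`isClassicalNSSolutionOn_viscosityChange` with the
factor `a⁻¹`) to a classical finite-energy solution of the design's own system on `[0, T]`.
[cite: FeffermanClay2006, (C)] [cite: Tao2011, footnote 3] -/
theorem navierStokesBreakdownR3_of_not_livesTo {μ : ℝ} (hμ : 0 < μ) (S : Schedule R) {T : ℝ}
    (hT : 0 < T) (h₀ : ContDiff ℝ ∞ S.u₀) (hdiv : NSWave0.IsDivFree S.u₀) (h : ¬ S.LivesTo μ T) :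
    Summit.NavierStokesRegularity.NavierStokesRegularity.NavierStokesBreakdownR3 := by
  intro ν hν
  -- the dilation factor: from viscosity `μ` to viscosity `a * μ = ν`
  set a : ℝ := ν / μ with ha
  have ha0 : 0 < a := div_pos hν hμ
  have hane : a ≠ 0 := ha0.ne'
  have hbμ : a⁻¹ * ν = μ := by
    rw [ha, inv_div, div_mul_cancel₀ μ hν.ne']
  -- the dilated Clay data
  refine ⟨fun x => a • S.u₀ x, timeRescale a (a ^ 2) S.f, h₀.const_smul a,
    VectorCalculus.IsDivFree.const_smul (h₀.differentiable (by simp)) hdiv a,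
    hasRapidSpatialDecay_const_smul S.datum_decay h₀ a,
    isSmoothOnHalfSpace_timeRescale S.force_smooth ha0.le _,
    hasRapidSpaceTimeDecay_timeRescale S.force_smooth S.force_decay ha0 _, ?_⟩
  -- a global Clay-class solution for the dilated data dilates back to a life of the design to `T`
  rintro ⟨v, q, hv, hq, hns, hE⟩
  apply h
  have hcl : IsClassicalNSSolutionOn (Ici 0) ν (timeRescale a (a ^ 2) S.f) v q ∧
      v 0 = fun x => a • S.u₀ x :=
    isNavierStokesSolution_and_smooth_iff.mp ⟨hns, hv, hq⟩
  have hmaps : MapsTo (fun s => a⁻¹ * s) (Ici (0 : ℝ)) (Ici 0) := fun s hs =>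
    mul_nonneg (inv_nonneg.2 ha0.le) hs
  have hcl' := Theorems.isClassicalNSSolutionOn_viscosityChange hcl.1 a⁻¹ hmaps (uniqueDiffOn_Ici 0)
  rw [hbμ, timeRescale_inv_timeRescale hane (by field_simp)] at hcl'
  refine ⟨timeRescale a⁻¹ a⁻¹ v, timeRescale a⁻¹ (a⁻¹ ^ 2) q,
    hcl'.mono (fun t ht => ht.1) (uniqueDiffOn_Icc hT), ?_, ?_⟩
  · funext x
    simp only [timeRescale_apply, mul_zero, hcl.2, smul_smul, inv_mul_cancel₀ hane, one_smul]
  · obtain ⟨C, hC, hb⟩ := hE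
    refine ⟨ENNReal.ofReal (a⁻¹ ^ 2) * C, ENNReal.mul_lt_top ENNReal.ofReal_lt_top hC,
      fun t ht => ?_⟩
    simp only [timeRescale_apply]
    rw [lintegral_enorm_sq_const_smul]
    exact mul_le_mul_right (hb (a⁻¹ * t) (mul_nonneg (inv_nonneg.2 ha0.le) ht.1)) _

end Schedule

namespace Stage

variable {ν : ℝ} {R : TowerRates} {S : Schedule R} {m : Margins R} {k : ℕ}

/-- **A registered design that dies IS (C)**: a design with a stage at some level (so its Clay datum is
smooth and divergence free) whose flow does not live to some `T > 0` gives `NavierStokesBreakdownR3`.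
[cite: FeffermanClay2006, (C)] -/
theorem navierStokesBreakdownR3_of_not_livesTo (hν : 0 < ν) (s : Stage ν R S m k) {T : ℝ}
    (hT : 0 < T) (h : ¬ S.LivesTo ν T) :
    Summit.NavierStokesRegularity.NavierStokesRegularity.NavierStokesBreakdownR3 :=
  S.navierStokesBreakdownR3_of_not_livesTo hν hT s.contDiff_datum s.divFree_datum h

end Stage

/-! ## §3 Heredity OR breakdown (never asserted here) -/

/-- **HEREDITY OR BREAKDOWN at level `k`** (open; never asserted): every globally anchored registered
stage at level `k` of a pinned (`Λ = 8`, `θ = 6/5`), rigid, quiet design on the wide-base rates, at unit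
viscosity, EITHER belongs to a design whose flow does not live to `τ (k+1)` (then the design is itself a
Clay (C) witness, `Stage.navierStokesBreakdownR3_of_not_livesTo`) OR extends to a registered stage at
level `k + 1`. The register's `HeredityAt k` minus the clause «no premature blow-up».
[cite: Palasek2026ElementaryModel, §4] -/
@[conjecture] def HeredityOrBreakdownAt (k : ℕ) : Prop :=
  ∀ S : Schedule TowerRates.wide, S.Pins 8 (6 / 5) → S.Rigid → S.Quiet →
    ∀ s : Stage 1 TowerRates.wide S (Margins.routeG TowerRates.wide) k,
      ¬ S.LivesTo 1 (S.τ (k + 1)) ∨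
        ∃ s' : Stage 1 TowerRates.wide S (Margins.routeG TowerRates.wide) (k + 1), s.Extends s'

/-- **Heredity or breakdown FROM level `k₀` on** (open; never asserted). [cite: Palasek2026ElementaryModel, §4] -/
@[conjecture] def HeredityOrBreakdownFrom (k₀ : ℕ) : Prop :=
  ∀ k : ℕ, k₀ ≤ k → HeredityOrBreakdownAt k

/-- **No premature breakdown at level `k`** (open; never asserted; the clause that `HeredityAt k`
carries and (C) does not need): every pinned rigid quiet design on the wide-base rates that earned a
registered stage at level `k` has a flow living (classically, with finite energy) to `τ (k+1)`. Its
NEGATION proves (C) (`navierStokesBreakdownR3_of_not_noPrematureBreakdownAt`). [cite: Palasek2026ElementaryModel, §4] -/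
@[conjecture] def NoPrematureBreakdownAt (k : ℕ) : Prop :=
  ∀ S : Schedule TowerRates.wide, S.Pins 8 (6 / 5) → S.Rigid → S.Quiet →
    Nonempty (Stage 1 TowerRates.wide S (Margins.routeG TowerRates.wide) k) → S.LivesTo 1 (S.τ (k + 1))

/-- Heredity at level `k` implies heredity-or-breakdown at level `k` (free direction). [folklore] -/
theorem HeredityAt.orBreakdown {k : ℕ} (h : HeredityAt k) : HeredityOrBreakdownAt k :=
  fun S hP hR hQ s => Or.inr (h S hP hR hQ s)

/-- Heredity at level `k` implies no premature breakdown at level `k` (the extension lives to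
`τ (k+1)`). [folklore] -/
theorem HeredityAt.noPrematureBreakdown {k : ℕ} (h : HeredityAt k) : NoPrematureBreakdownAt k := by
  rintro S hP hR hQ ⟨s⟩
  obtain ⟨s', -⟩ := h S hP hR hQ s
  exact s'.livesTo

/-- Heredity from `k₀` implies heredity-or-breakdown from `k₀`. [folklore] -/
theorem HeredityFrom.orBreakdown {k₀ : ℕ} (h : HeredityFrom k₀) : HeredityOrBreakdownFrom k₀ :=
  fun _ hk => (h.heredityAt hk).orBreakdown

/-- **`HeredityAt k ↔ HeredityOrBreakdownAt k ∧ NoPrematureBreakdownAt k`** — the register's heredity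
is EXACTLY the weak form plus the clause «no registered design dies before `τ (k+1)`». [folklore] -/
theorem heredityAt_iff_orBreakdown_and_noPrematureBreakdown (k : ℕ) :
    HeredityAt k ↔ HeredityOrBreakdownAt k ∧ NoPrematureBreakdownAt k := by
  refine ⟨fun h => ⟨h.orBreakdown, h.noPrematureBreakdown⟩, fun ⟨hO, hN⟩ S hP hR hQ s => ?_⟩
  rcases hO S hP hR hQ s with hdead | hext
  · exact absurd (hN S hP hR hQ ⟨s⟩) hdead
  · exact hext

/-- Heredity-or-breakdown from `k₀` and no premature breakdown at every `k ≥ k₀` give heredity from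
`k₀`. [folklore] -/
theorem heredityFrom_iff_orBreakdown_and_noPrematureBreakdown (k₀ : ℕ) :
    HeredityFrom k₀ ↔ HeredityOrBreakdownFrom k₀ ∧ ∀ k, k₀ ≤ k → NoPrematureBreakdownAt k := by
  refine ⟨fun h => ⟨h.orBreakdown, fun k hk => (h.heredityAt hk).noPrematureBreakdown⟩,
    fun ⟨hO, hN⟩ S hP hR hQ k hk s => ?_⟩
  exact (heredityAt_iff_orBreakdown_and_noPrematureBreakdown k).2 ⟨hO k hk, hN k hk⟩ S hP hR hQ s

/-- **A premature breakdown IS Fefferman's (C)**: if some pinned rigid quiet design with a registered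
stage at level `k` has a flow that does not live to `τ (k+1)`, then `NavierStokesBreakdownR3`.
[cite: FeffermanClay2006, (C)] -/
theorem navierStokesBreakdownR3_of_not_noPrematureBreakdownAt {k : ℕ} (h : ¬ NoPrematureBreakdownAt k) :
    Summit.NavierStokesRegularity.NavierStokesRegularity.NavierStokesBreakdownR3 := by
  simp only [NoPrematureBreakdownAt, not_forall] at h
  obtain ⟨S, _, _, _, ⟨s⟩, hdead⟩ := h
  exact s.navierStokesBreakdownR3_of_not_livesTo one_pos (S.τ_pos (k + 1)) hdead

/-- **The weak form recovers the register's heredity OR proves (C) outright.** [folklore] -/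
theorem HeredityOrBreakdownAt.heredityAt_or_breakdownR3 {k : ℕ} (h : HeredityOrBreakdownAt k) :
    HeredityAt k ∨ Summit.NavierStokesRegularity.NavierStokesRegularity.NavierStokesBreakdownR3 := by
  by_cases hN : NoPrematureBreakdownAt k
  · exact Or.inl ((heredityAt_iff_orBreakdown_and_noPrematureBreakdown k).2 ⟨h, hN⟩)
  · exact Or.inr (navierStokesBreakdownR3_of_not_noPrematureBreakdownAt hN)

/-- **Without breakdown the two items coincide**: if (C) fails, `HeredityAt k ↔ HeredityOrBreakdownAt k`
— the weakening discards exactly the designs that would hand over (C) directly. [folklore] -/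
theorem heredityAt_iff_orBreakdown_of_not_breakdownR3 {k : ℕ}
    (hC : ¬ Summit.NavierStokesRegularity.NavierStokesRegularity.NavierStokesBreakdownR3) :
    HeredityAt k ↔ HeredityOrBreakdownAt k :=
  ⟨HeredityAt.orBreakdown, fun h => h.heredityAt_or_breakdownR3.resolve_right hC⟩

/-- Any refutation of the register's heredity at level `k` either refutes the weak form or proves (C).
[folklore] -/
theorem not_orBreakdown_or_breakdownR3_of_not_heredityAt {k : ℕ} (h : ¬ HeredityAt k) :
    ¬ HeredityOrBreakdownAt k ∨
      Summit.NavierStokesRegularity.NavierStokesRegularity.NavierStokesBreakdownR3 := by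
  by_cases hO : HeredityOrBreakdownAt k
  · exact Or.inr (hO.heredityAt_or_breakdownR3.resolve_left h)
  · exact Or.inl hO

/-! ## §4 The closer with weakened binders -/

/-- **THE CLOSER, weak binders: `EpisodeBaseG → HeredityOrBreakdownFrom 1 → (C)`.** The base design's
chain of registered stages either reaches every level — then it realises the tower and
`navierStokesBreakdownR3_of_nonempty_stages` (PATH B′, no named fact) gives (C) — or it stops at a
finite level `K + 1 ≥ 2` with a stage at level `K` whose design does not live to `τ (K+1)` — then the
breakdown door gives (C). [cite: FeffermanClay2006, (C)] [cite: Palasek2026ElementaryModel, §4] -/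
theorem navierStokesBreakdownR3_of_base_orBreakdownFrom_one (h₁ : EpisodeBaseG)
    (h₂ : HeredityOrBreakdownFrom 1) :
    Summit.NavierStokesRegularity.NavierStokesRegularity.NavierStokesBreakdownR3 := by
  obtain ⟨S, hP, hR, hQ, ⟨s₁⟩⟩ := h₁
  by_contra hC
  -- without breakdown, the chain of this design reaches every level `k ≥ 1` …
  have hst : ∀ k, 1 ≤ k → Nonempty (Stage 1 TowerRates.wide S (Margins.routeG TowerRates.wide) k) := by
    intro k hk
    induction k, hk using Nat.le_induction with
    | base => exact ⟨s₁⟩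
    | succ k hk ih =>
      obtain ⟨s⟩ := ih
      rcases h₂ k hk S hP hR hQ s with hdead | ⟨s', -⟩
      · exact absurd (s.navierStokesBreakdownR3_of_not_livesTo one_pos (S.τ_pos (k + 1)) hdead) hC
      · exact ⟨s'⟩
  -- … and level `0` by restriction, so it realises the tower: contradiction
  refine hC (navierStokesBreakdownR3_of_nonempty_stages one_pos (S := S) fun k => ?_)
  rcases Nat.eq_zero_or_pos k with rfl | hk
  · exact ⟨s₁.restrictOfAntitone (Margins.antitone_routeG TowerRates.wide) (Nat.zero_le 1)⟩
  · exact hst k hk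

/-- Heredity-or-breakdown at `k₀` and from `k₀ + 1` give it from `k₀`. [folklore] -/
theorem HeredityOrBreakdownAt.from {k₀ : ℕ} (h₀ : HeredityOrBreakdownAt k₀)
    (h₁ : HeredityOrBreakdownFrom (k₀ + 1)) : HeredityOrBreakdownFrom k₀ := by
  intro k hk
  rcases hk.eq_or_lt with rfl | hlt
  · exact h₀
  · exact h₁ k hlt

/-- **THE CLOSER, split form: `EpisodeBaseG → HeredityOrBreakdownAt 1 → HeredityOrBreakdownFrom 2 → (C)`**
— the route's deciding theorem `closes (h₁ : EpisodeBase) (h₂ : HeredityAtOne) (h₃ : HeredityFromTwo)` with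
BOTH heredity binders replaced by their weak forms (`HeredityAt.orBreakdown`, `HeredityFrom.orBreakdown`
recover it). [cite: FeffermanClay2006, (C)] -/
theorem navierStokesBreakdownR3_of_base_orBreakdownAt_one_orBreakdownFrom_two (h₁ : EpisodeBaseG)
    (h₂ : HeredityOrBreakdownAt 1) (h₃ : HeredityOrBreakdownFrom 2) :
    Summit.NavierStokesRegularity.NavierStokesRegularity.NavierStokesBreakdownR3 :=
  navierStokesBreakdownR3_of_base_orBreakdownFrom_one h₁ (h₂.from h₃)

/-- The register's closer re-derived through the weak one (sanity: nothing was lost). [folklore] -/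
theorem navierStokesBreakdownR3_of_base_heredityAtOne_heredityFrom_two' (h₁ : EpisodeBaseG)
    (h₂ : HeredityAtOne) (h₃ : HeredityFrom 2) :
    Summit.NavierStokesRegularity.NavierStokesRegularity.NavierStokesBreakdownR3 :=
  navierStokesBreakdownR3_of_base_orBreakdownAt_one_orBreakdownFrom_two h₁
    (HeredityAt.orBreakdown h₂) h₃.orBreakdown

/-! ## §5 The weak item in certificate shape: the heredity witness of the designs that survive -/

/-- **`HeredityOrBreakdownAt k` ↔ «every pinned rigid quiet design with a registered level-`k` stage
WHOSE FLOW LIVES to `τ (k+1)` has a level witness at level `k`»** (cf. `HeredityWitness k`, which asks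
the witness of every such design, alive or not). (→) the extension `s'` exists; the surviving flow IS
`s'.u` on `[0, τ (k+1)]` (`Stage.velocity_eq_of_classical`, forced Serrin–Masuda — a theorem), so it
carries `s'`'s window ceiling and level-`k+1` floors. (←) `Stage.nonempty_extends_of_levelWitness'`
(unconditional reduction). [cite: Sohr2001, Ch. V Thm. 1.5.1] -/
theorem heredityOrBreakdownAt_iff_levelWitness_of_livesTo (k : ℕ) :
    HeredityOrBreakdownAt k ↔
      ∀ S : Schedule TowerRates.wide, S.Pins 8 (6 / 5) → S.Rigid → S.Quiet →
        Nonempty (Stage 1 TowerRates.wide S (Margins.routeG TowerRates.wide) k) →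
          S.LivesTo 1 (S.τ (k + 1)) → S.LevelWitness 1 k := by
  constructor
  · rintro h S hP hR hQ ⟨s⟩ hlive
    rcases h S hP hR hQ s with hdead | ⟨s', -⟩
    · exact absurd hlive hdead
    · obtain ⟨v, q, hcl, hv0, hE⟩ := hlive
      have hvel : ∀ t ∈ Icc 0 (S.τ (k + 1)), v t = s'.u t :=
        s'.velocity_eq_of_classical one_pos le_rfl hcl hv0 hE
      have hτ : S.τ (k + 1) ∈ Icc 0 (S.τ (k + 1)) := ⟨(S.τ_pos (k + 1)).le, le_rfl⟩
      refine ⟨v, q, hcl, hv0, hE, ?_, ?_, ?_, ?_⟩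
      · intro t ht x
        rw [hvel t ⟨(S.τ_pos k).le.trans ht.1, ht.2⟩]
        exact s'.ceiling (k + 1) le_rfl t ⟨(S.τ_pos k).le.trans ht.1, ht.2⟩ x
      · rw [hvel _ hτ]; exact s'.floor (k + 1) le_rfl
      · rw [hvel _ hτ]; exact s'.routeG_strain (k + 1) le_rfl
      · rw [hvel _ hτ]; exact s'.routeG_coreLedger (k + 1) le_rfl
  · intro h S hP hR hQ s
    by_cases hlive : S.LivesTo 1 (S.τ (k + 1))
    · exact Or.inr (s.nonempty_extends_of_levelWitness' one_pos (h S hP hR hQ ⟨s⟩ hlive))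
    · exact Or.inl hlive

/-- In particular the heredity WITNESS at level `k` implies the weak form (a witness lives). [folklore] -/
theorem HeredityWitness.orBreakdown {k : ℕ} (h : HeredityWitness k) : HeredityOrBreakdownAt k :=
  (heredityOrBreakdownAt_iff_levelWitness_of_livesTo k).2 fun S hP hR hQ hs _ => h S hP hR hQ hs

end Summit.NavierStokesRegularity.FluidComputer.PalasekTowerClayBridge

end
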